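import Mathlib
import HarnessLib
import Literature.Analysis.FluidPDE.PressurePoisson
import Literature.Analysis.FluidPDE.LerayProfileCalculus
import Literature.Analysis.FluidPDE.VectorCalculus
import Literature.Analysis.FluidPDE.VectorCalculusProofs

/-!
# Crux `IsobarTomography.BlobRiccatiClosure` (stmt-NavierStokesRegularity-11740), line `Sketch`,
# stub S2 `stub_pressureLaplacian` — the pressure Poisson equation in peak currency

Registered stub S2 of the peak-reduction skeleton `Cruxes/BlobRiccatiClosure/Lines/Sketch.lean`:
for a classical solution `(u, p)` of the unforced Navier–Stokes system on `ℝ³ × [0, T)` and an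
interior time `t ∈ (0, T)`,

  `Δp(t, x) = ‖curl u(t, x)‖² − |∇u(t, x)|²_F`

(equivalently `½‖ω‖² − |S|²_F` with `S` the strain, i.e. `Δp = 2Q`).

Proof (every ingredient is a theorem of the tree): the divergence of the momentum equation at an
interior time is the pressure Poisson equation `Δp(t) = −div((u·∇)u)(t) + div f(t)`
(`laplacian_pressure_eq_of_isClassicalNSSolutionOn`, Tao 2013 eq. (8)), here with `f = 0`;
for the divergence-free smooth slice `u(t)`, `div((u·∇)u) = tr(∇u ∘ ∇u)`
(`divergence_convect_self_eq`); and the linear algebra `tr(A ∘ A) = |A|²_F − ½|A − Aᵀ|²_F`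
(`frobeniusNormSq_sub_adjoint`) combined with `‖curl u‖² = ½|∇u − ∇uᵀ|²_F`
(`norm_curl_sq_eq_frobeniusNormSq_spin_holds`, Majda–Bertozzi §1.4) gives
`tr(∇u ∘ ∇u) = |∇u|²_F − ‖curl u‖²`.

Sanity check (rigid rotation `u = (−y, x, 0)`, `p = (x² + y²)/2`): `|∇u|²_F = 2`, `‖curl u‖² = 4`,
`Δp = 2 = 4 − 2`.

References: T. Tao, *Localisation and compactness properties of the Navier–Stokes global
regularity problem*, Anal. PDE 6 (2013) 25–107, eq. (8); A. J. Majda, A. L. Bertozzi,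
*Vorticity and Incompressible Flow* (CUP 2002), §1.2 (1.13) and §1.4 (1.18)–(1.22).
-/

noncomputable section

open Set Function Filter Topology
open scoped InnerProductSpace RealInnerProductSpace Laplacian ContDiff

-- the summit and its single sub-problem share the name (CONVENTIONS §1), as in every Theorems file
set_option linter.dupNamespace false

namespace Summit.NavierStokesRegularity.NavierStokesRegularity.Theorems.BlobRiccatiClosure.Sketch

open Literature.Analysis Literature.Analysis.FluidPDE

local notation "E³" => EuclideanSpace ℝ (Fin 3)

/-- **`tr(A ∘ A) = |A|²_F − ‖curl v(x)‖²` for `A = Dv(x)`**, `v : ℝ³ → ℝ³` differentiable at `x`: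
from `|A − Aᵀ|²_F = 2(|A|²_F − tr(A ∘ A))` (`frobeniusNormSq_sub_adjoint`) and
`‖curl v(x)‖² = ½|A − Aᵀ|²_F` (`norm_curl_sq_eq_frobeniusNormSq_spin_holds`). -/
theorem traceCLM_comp_self_fderiv_eq_frobeniusNormSq_sub_norm_curl_sq {v : E³ → E³} {x : E³}
    (hv : DifferentiableAt ℝ v x) :
    traceCLM ((fderiv ℝ v x).comp (fderiv ℝ v x)) =
      frobeniusNormSq (fderiv ℝ v x) - ‖curl v x‖ ^ 2 := by
  have h1 := frobeniusNormSq_sub_adjoint (fderiv ℝ v x)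
  have h2 : ‖curl v x‖ ^ 2 =
      2⁻¹ * frobeniusNormSq (fderiv ℝ v x - ContinuousLinearMap.adjoint (fderiv ℝ v x)) := by
    have h := norm_curl_sq_eq_frobeniusNormSq_spin_holds v x hv
    simpa only [spin] using h
  rw [h2, h1]
  ring

/-- **S2, PRESSURE LAPLACIAN.** For a classical solution of unforced Navier–Stokes on `[0, T)` and an
interior time `t ∈ (0, T)`: `Δp(t,x) = ‖curl u(t,x)‖² − |∇u(t,x)|²_F` (equivalently `½‖ω‖² − |S|²_F`,
i.e. `Δp = 2Q`). Take the divergence of the momentum equation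
(`laplacian_pressure_eq_of_isClassicalNSSolutionOn`), use `div((u·∇)u) = tr(∇u ∘ ∇u)`
(`divergence_convect_self_eq`) and the algebra `tr(A²) = |A|²_F − ‖curl‖²`. -/
theorem stub_pressureLaplacian :
    ∀ (ν T : ℝ) (u : ℝ → E³ → E³) (p : ℝ → E³ → ℝ),
      IsClassicalNSSolutionOn (Ico 0 T) ν 0 u p →
      ∀ t ∈ Ioo 0 T, ∀ x : E³,
        Laplacian.laplacian (p t) x = ‖curl (u t) x‖ ^ 2 - frobeniusNormSq (fderiv ℝ (u t) x) := by
  intro ν T u p h t ht x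
  -- `t` is an interior time of `[0, T)`
  have hti : t ∈ interior (Ico 0 T) := by
    rw [interior_Ico]
    exact ht
  have htS : t ∈ Ico 0 T := Ioo_subset_Ico_self ht
  -- regularity and incompressibility of the slice `u(t)`
  have hu : ContDiff ℝ ∞ (u t) := h.contDiff_velocity htS
  have hu2 : ContDiff ℝ 2 (u t) := contDiff_infty.1 hu 2
  have hud : DifferentiableAt ℝ (u t) x :=
    ((contDiff_infty.1 hu 1).differentiable one_ne_zero) x
  have hdiv : VectorCalculus.IsDivFree (u t) := h.divFree t htS
  -- the pressure Poisson equation with zero force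
  have hP := laplacian_pressure_eq_of_isClassicalNSSolutionOn h hti x
  have h0 : VectorCalculus.divergence ((0 : ℝ → E³ → E³) t) x = 0 := by
    simp [VectorCalculus.divergence]
  rw [h0, add_zero, divergence_convect_self_eq hu2 hdiv,
    traceCLM_comp_self_fderiv_eq_frobeniusNormSq_sub_norm_curl_sq hud] at hP
  rw [hP]
  ring

end Summit.NavierStokesRegularity.NavierStokesRegularity.Theorems.BlobRiccatiClosure.Sketch

end
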